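/-
Copyright: the b2b-balaban T⁴-continuum CRUX team, row NE7b OWNER lineage `t4-ne7b-p1` (gen 124). Project licence.
-/
import Summits.QuantumFields.BalabanUV.T4Continuum.Spine.NE7b.SupZdCoarseInverse
import Mathlib.Analysis.Normed.Group.Tannery

/-!
# THE INFINITE-VOLUME NEXT-SCALE HESSIAN KERNEL IS THE TWO-SIDED INVERSE OF `T_∞`, AND THE ONLY BOUNDED ONE: for the cube limit `M` of
# the section inverses of `T_∞ = Q′H_∞⁻¹Q′*` on `ℤ^d` ((194); `V : ℤ^d → [−λ, Λ]`, `d ≥ 3`, ANY bounded block columns): `M(b,b′) = M(b′,b)`,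
# `Σ′_{b″}T_∞(b,b″)M(b″,b′) = δ_{bb′} = Σ′_{b″}M(b,b″)T_∞(b″,b′)` with absolutely convergent rows, and every BOUNDED kernel `N` that is a
# left OR a right inverse of `T_∞` in this sense IS `M` — so `(n+1)^d·M` is THE infinite-volume next-scale Hessian kernel of the road's
# class, an object independent of the exhaustion (row NE7b, node U5c; (186)∕(189)∕(194) BY NAME + Tannery's theorem; [folklore])

Cell `pub-balaban`, sub-cell `t4`, spine estimate NE7b (`T4WeightBudget.RelWeightBound`; the cell's OWN estimate — NOT PRINTED in
[Bałaban 1983–89], NOT PROVED).  Crux-route work under `Spine/NE7b/` by the row OWNER (`t4-ne7b-p1` gen 124, file (195)) under FREEZE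
(0)'s crux-prover clause; NOTHING of Bałaban's is named as a Lean object, valued or asserted; no `T4Continuum/Support` leaf typed; no `def`,
no notation (`T_∞`'s entries, the sections, the cube limit DISPLAYED; `M` is ANY kernel with (194) (i) — statements about all of them, and
§4 says there is only one); zero `sorry`.  Imports (BY NAME): the OWNER's (194) `…SupZdCoarseInverse` (`zd_coarse_symmetric'`,
`zd_coarse_section_hyp56`, `zd_coarse_section_inverse`, `mem_cube_of_l1_le`; through it (186) `zd_coarse_entry_decay`, (189)
`summable_exp_l1`, `tsum_exp_l1_le`, (191) `natAbs_sub_comm_sum`, the Literature engine `B4Sect5Torus.isUnit_of_hyp56`), Mathlib's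
`tendsto_tsum_of_dominated_convergence` (Tannery), `Summable.tsum_comm`, `summable_prod_of_nonneg`, `Matrix.mul_nonsing_inv`,
`Matrix.nonsing_inv_mul`, `Matrix.transpose_nonsing_inv`, `tsum_eq_sum`, `tsum_eq_single`.

WHY (located).  (194) produced the kernel `M` as a limit with decay and the infinite-volume (5.8); to BE the inverse of `T_∞` on `ℓ^∞(ℤ^d)`
(where (188)∕(189) placed the column) it must satisfy the two row identities, and to be THE next-scale Hessian it must not depend on the
cubes: both follow from the finite identities `T_S(T_S)⁻¹ = 1` on the cubes — for `b, b′ ∈ [−R,R]^d` that identity IS the `ℤ^d` series of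
`T_∞(b,·)` against the zero-extended section inverse, dominated by the summable `C e^{−δ|b − ·|₁}·c₁` uniformly in `R` and converging
termwise, so Tannery's theorem passes `R → ∞`; `MT_∞ = 1` by the two symmetries; and a bounded left inverse `N` equals `N(T_∞M) = (NT_∞)M =
M` by Fubini on `ℤ^d × ℤ^d` (absolute convergence from (186)'s entry decay and `M`'s decay), a bounded right inverse by transposition.

WHAT IS PROVED ([folklore]; `X d = ℤ^d`; `T(b,b′) = (n+1)^{−d}Σ_{q ∈ B n b}Ψ_{b′} q` DISPLAYED; `M` ANY kernel with the cube-limit property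
(194) (i)): §1 **`zd_coarse_section_identities`** (`Σ_{b″ ∈ S}T(b,b″)(T_S)⁻¹(b″,b′) = δ_{bb′} = Σ_{b″ ∈ S}(T_S)⁻¹(b,b″)T(b″,b′)`, `(T_S)⁻¹`
symmetric — the floor makes `T_S` a unit); §2 **`zd_coarse_inverse_symmetric`** (`M(b,b′) = M(b′,b)`); §3 `zd_coarse_inverse_decay`
(`|M| ≤ c₁e^{−δ₁ρ}` with (194) §4's constants), **`zd_coarse_mul_inverse`** (`Summable` and `Σ′_{b″}T(b,b″)M(b″,b′) = δ_{bb′}`),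
**`zd_coarse_inverse_mul`** (`Σ′_{b″}M(b,b″)T(b″,b′) = δ_{bb′}`); §4 **`zd_coarse_left_inverse_unique`** (`|N| ≤ K`, `Σ′N(b,·)T(·,b″) = δ` ⟹
`N = M`), **`zd_coarse_right_inverse_unique`** (`Σ′T(b,·)N(·,b′) = δ` ⟹ `N = M`); §5 toy.

HONEST (what this is NOT).  Kernel identities only — the packaging of `M` as a bounded operator on `ℓ^∞(ℤ^d)` ∕ `ℓ²(ℤ^d)` ((188)∕(191)'s
pattern), the convergence of the TORUS next-scale Hessians `T_k⁻¹(σ_k b, σ_k b′) → M(b,b′)`, the `ℤ^d` response and covariance, and the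
Lipschitz dependence of `M` on `V` are the sequel; `d ≥ 3` only; the LINEAR column only; scalar skeleton ((A3), NC-NE7b-α UNRULED); nothing
of the covariant propagators of [B4]–[B6]; nothing of Bałaban's asserted.  BY-NAME EFFECT ON THE WALL: NONE.  NE7b NOT PRINTED ∕ NOT PROVED;
spine PROVED 0∕9; rung (B)+1 — the programme's measures remain FINITE-torus statements; NOT the mass gap, NOT Clay.  HONEST DEPENDENCY:
continuum YM on T⁴ ⇐ BetaPertH ∧ nine spine estimates (0∕9 proved); BetaPertH ⇐ (D1) ∧ (D4) ∧ CAP+tail; G-an2-4 gates asym, D1 and NE2∕3∕4.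
-/

set_option autoImplicit false

noncomputable section

namespace Summit.QuantumFields.BalabanUV.T4Continuum.NE7b.SupZdCoarseInverseIdentities

open Real Filter Topology
open Literature.MathematicalPhysics.QuantumFieldTheory.Balaban1983to89
open B6QGQLower276 (X e blk B side chart mem_B sum_B sum_B_const card_cube blk_chart)
open B4Sect5Torus (isUnit_of_hyp56)
open SupZdCoarseOperator (zd_coarse_entry_decay)
open SupZdExponentialSums (summable_exp_l1 tsum_exp_l1_le)
open SupZdCoarseForm (natAbs_sub_comm_sum)
open SupZdCoarseInverse (zd_coarse_symmetric' zd_coarse_section_hyp56 zd_coarse_section_inverse mem_cube_of_l1_le)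

variable {d : ℕ}

section Road

variable (hd : 3 ≤ d) (a : ℝ) (ha : 0 < a) {lam Lam : ℝ} (hlam : lam < min 2 a) (hLam : 0 ≤ Lam)
  (n : ℕ) (V : X d → ℝ) (hV : ∀ p, -lam ≤ V p) (hV' : ∀ p, V p ≤ Lam)
  (Ψ : X d → X d → ℝ) (BΨ : X d → ℝ) (hΨB : ∀ b' p, |Ψ b' p| ≤ BΨ b')
  (hΨ : ∀ b' p, ((n : ℝ) + 1) ^ 2 * ∑ μ, (2 * Ψ b' p - Ψ b' (p + e μ) - Ψ b' (p - e μ))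
    + a / ((n : ℝ) + 1) ^ d * ∑ q ∈ B n (blk n p), Ψ b' q + V p * Ψ b' p = if blk n p = b' then 1 else 0)

/-! ## §1. Section identities -/

include hd ha hlam hLam hV hV' hΨB hΨ in
/-- **SECTION IDENTITIES**: every finite section `T_S` is invertible (the floor), `T_S·T_S⁻¹ = 1 = T_S⁻¹·T_S` entrywise, and `T_S⁻¹` is
symmetric. [folklore] -/
theorem zd_coarse_section_identities (S : Finset (X d)) (b b' : S) :
    ∑ b'' : S, ((((n : ℝ) + 1) ^ d)⁻¹ * ∑ q ∈ B n (b : X d), Ψ (b'' : X d) q)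
        * (Matrix.of fun b b' : S => (((n : ℝ) + 1) ^ d)⁻¹ * ∑ q ∈ B n (b : X d), Ψ (b' : X d) q)⁻¹ b'' b'
      = (if b = b' then 1 else 0) ∧
    ∑ b'' : S, (Matrix.of fun b b' : S => (((n : ℝ) + 1) ^ d)⁻¹ * ∑ q ∈ B n (b : X d), Ψ (b' : X d) q)⁻¹ b b''
        * ((((n : ℝ) + 1) ^ d)⁻¹ * ∑ q ∈ B n (b'' : X d), Ψ (b' : X d) q)
      = (if b = b' then 1 else 0) ∧
    (Matrix.of fun b b' : S => (((n : ℝ) + 1) ^ d)⁻¹ * ∑ q ∈ B n (b : X d), Ψ (b' : X d) q)⁻¹ b b'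
      = (Matrix.of fun b b' : S => (((n : ℝ) + 1) ^ d)⁻¹ * ∑ q ∈ B n (b : X d), Ψ (b' : X d) q)⁻¹ b' b := by
  classical
  obtain ⟨C, δ, hC, hδ, H56⟩ := zd_coarse_section_hyp56 (d := d) hd a ha hlam hLam
  have hγ : (0 : ℝ) < 1 / ((36 : ℝ) ^ d * (4 * d + a + Lam)) := by positivity
  set A : Matrix S S ℝ := Matrix.of fun b b' : S => (((n : ℝ) + 1) ^ d)⁻¹ * ∑ q ∈ B n (b : X d), Ψ (b' : X d) q with hA
  have h56 := H56 n V hV hV' Ψ BΨ hΨB hΨ S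
  have hunit : IsUnit A.det := (Matrix.isUnit_iff_isUnit_det A).1 (isUnit_of_hyp56 hγ h56)
  refine ⟨?_, ?_, ?_⟩
  · have h := congrFun (congrFun (Matrix.mul_nonsing_inv A hunit) b) b'
    rw [Matrix.mul_apply, Matrix.one_apply] at h
    simpa only [hA, Matrix.of_apply] using h
  · have h := congrFun (congrFun (Matrix.nonsing_inv_mul A hunit) b) b'
    rw [Matrix.mul_apply, Matrix.one_apply] at h
    simpa only [hA, Matrix.of_apply] using h
  · have hT : A⁻¹.transpose = A⁻¹ := by rw [Matrix.transpose_nonsing_inv, h56.1.eq]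
    have h := congrFun (congrFun hT b') b
    rw [Matrix.transpose_apply] at h
    exact h

/-! ## §2. The limit kernel is symmetric -/

variable (M : X d → X d → ℝ)
  (hM : ∀ b b' : X d, Tendsto (fun R : ℕ =>
      if h : b ∈ (Fintype.piFinset fun _ : Fin d => Finset.Icc (-(R : ℤ)) R) ∧
          b' ∈ (Fintype.piFinset fun _ : Fin d => Finset.Icc (-(R : ℤ)) R)
        then (Matrix.of fun c c' : ↥(Fintype.piFinset fun _ : Fin d => Finset.Icc (-(R : ℤ)) R) =>
          (((n : ℝ) + 1) ^ d)⁻¹ * ∑ q ∈ B n (c : X d), Ψ (c' : X d) q)⁻¹ ⟨b, h.1⟩ ⟨b', h.2⟩ else 0)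
    atTop (𝓝 (M b b')))

include hd ha hlam hLam hV hV' hΨB hΨ hM in
/-- **`M(b,b′) = M(b′,b)`** for EVERY kernel `M` that is the cube limit of the section inverses ((194) (i)): the section inverses are
symmetric (§1) and limits are unique. [folklore] -/
theorem zd_coarse_inverse_symmetric (b b' : X d) : M b b' = M b' b := by
  classical
  have h1 := hM b b'
  have h2 := hM b' b
  have heq : (fun R : ℕ =>
      if h : b' ∈ (Fintype.piFinset fun _ : Fin d => Finset.Icc (-(R : ℤ)) R) ∧
          b ∈ (Fintype.piFinset fun _ : Fin d => Finset.Icc (-(R : ℤ)) R)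
        then (Matrix.of fun c c' : ↥(Fintype.piFinset fun _ : Fin d => Finset.Icc (-(R : ℤ)) R) =>
          (((n : ℝ) + 1) ^ d)⁻¹ * ∑ q ∈ B n (c : X d), Ψ (c' : X d) q)⁻¹ ⟨b', h.1⟩ ⟨b, h.2⟩ else 0)
      = (fun R : ℕ =>
      if h : b ∈ (Fintype.piFinset fun _ : Fin d => Finset.Icc (-(R : ℤ)) R) ∧
          b' ∈ (Fintype.piFinset fun _ : Fin d => Finset.Icc (-(R : ℤ)) R)
        then (Matrix.of fun c c' : ↥(Fintype.piFinset fun _ : Fin d => Finset.Icc (-(R : ℤ)) R) =>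
          (((n : ℝ) + 1) ^ d)⁻¹ * ∑ q ∈ B n (c : X d), Ψ (c' : X d) q)⁻¹ ⟨b, h.1⟩ ⟨b', h.2⟩ else 0) := by
    funext R
    by_cases h : b ∈ (Fintype.piFinset fun _ : Fin d => Finset.Icc (-(R : ℤ)) R) ∧
        b' ∈ (Fintype.piFinset fun _ : Fin d => Finset.Icc (-(R : ℤ)) R)
    · rw [dif_pos h, dif_pos ⟨h.2, h.1⟩]
      exact ((zd_coarse_section_identities hd a ha hlam hLam n V hV hV' Ψ BΨ hΨB hΨ _ ⟨b, h.1⟩ ⟨b', h.2⟩).2.2).symm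
    · rw [dif_neg h, dif_neg fun h' => h ⟨h'.2, h'.1⟩]
  rw [heq] at h2
  exact tendsto_nhds_unique h1 h2

/-! ## §3. `T_∞·M = 1 = M·T_∞` on `ℤ^d` -/

include hd ha hlam hLam hV hV' hΨB hΨ hM in
/-- **THE LIMIT KERNEL IS UNDER THE SECTION PROFILE**: `|M(b,b′)| ≤ c₁e^{−δ₁|b − b′|₁}` with (194)'s section constants — a restatement of
(194) (ii) for ANY cube limit `M` (limits of the uniformly decaying section entries). [folklore] -/
theorem zd_coarse_inverse_decay :
    ∃ c₁ δ₁ : ℝ, 0 < c₁ ∧ 0 < δ₁ ∧ ∀ b b' : X d, |M b b'| ≤ c₁ * exp (-(δ₁ * ∑ i, (((b i - b' i).natAbs : ℕ) : ℝ))) := by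
  classical
  obtain ⟨c₁, δ₁, hc₁, hδ₁, H4⟩ := zd_coarse_section_inverse (d := d) hd a ha hlam hLam
  refine ⟨c₁, δ₁, hc₁, hδ₁, fun b b' => le_of_tendsto' (hM b b').abs fun R => ?_⟩
  split_ifs with h
  · exact (H4 n V hV hV' Ψ BΨ hΨB hΨ _ _ (Finset.Subset.refl _)).1 ⟨b, h.1⟩ ⟨b', h.2⟩
  · rw [abs_zero]; positivity

include hd ha hlam hLam hV hV' hΨB hΨ hM in
/-- **`T_∞·M = 1`**: for every `b, b′ ∈ ℤ^d` the row series `Σ′_{b″}T_∞(b,b″)M(b″,b′)` converges absolutely and equals `δ_{bb′}` — on the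
cube `[−R,R]^d ∋ b, b′` the finite identity `T_S(T_S)⁻¹ = 1` (§1) IS the series of `T_∞(b,·)·(zero-extended section inverse)(·,b′)`, whose
terms converge to `T_∞(b,·)M(·,b′)` under the summable domination `C e^{−δ|b − b″|₁}·c₁` ((186) entries, (194) §4 uniform section decay):
Tannery's theorem. [folklore] -/
theorem zd_coarse_mul_inverse (b b' : X d) :
    Summable (fun b'' : X d => ((((n : ℝ) + 1) ^ d)⁻¹ * ∑ q ∈ B n b, Ψ b'' q) * M b'' b') ∧
    ∑' b'' : X d, ((((n : ℝ) + 1) ^ d)⁻¹ * ∑ q ∈ B n b, Ψ b'' q) * M b'' b' = if b = b' then 1 else 0 := by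
  classical
  obtain ⟨C, δ, hC, hδ, H186⟩ := zd_coarse_entry_decay (d := d) hd a ha hlam hLam
  obtain ⟨c₁, δ₁, hc₁, hδ₁, H4⟩ := zd_coarse_section_inverse (d := d) hd a ha hlam hLam
  have hT : ∀ b'' : X d, |(((n : ℝ) + 1) ^ d)⁻¹ * ∑ q ∈ B n b, Ψ b'' q| ≤ C * exp (-(δ * ∑ i, (((b i - b'' i).natAbs : ℕ) : ℝ))) :=
    fun b'' => H186 n V hV hV' Ψ BΨ hΨB hΨ b b''
  -- the zero-extended cube-section inverses
  obtain ⟨MR, hMR⟩ : ∃ MR : ℕ → X d → X d → ℝ, ∀ R c c', MR R c c' =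
      if h : c ∈ (Fintype.piFinset fun _ : Fin d => Finset.Icc (-(R : ℤ)) R) ∧
          c' ∈ (Fintype.piFinset fun _ : Fin d => Finset.Icc (-(R : ℤ)) R)
        then (Matrix.of fun c c' : ↥(Fintype.piFinset fun _ : Fin d => Finset.Icc (-(R : ℤ)) R) =>
          (((n : ℝ) + 1) ^ d)⁻¹ * ∑ q ∈ B n (c : X d), Ψ (c' : X d) q)⁻¹ ⟨c, h.1⟩ ⟨c', h.2⟩ else 0 := ⟨_, fun _ _ _ => rfl⟩
  have hM' : ∀ c c' : X d, Tendsto (fun R : ℕ => MR R c c') atTop (𝓝 (M c c')) := fun c c' => by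
    simp only [hMR]; exact hM c c'
  have hbdR : ∀ R c c', |MR R c c'| ≤ c₁ := by
    intro R c c'
    rw [hMR]
    split_ifs with h
    · refine ((H4 n V hV hV' Ψ BΨ hΨB hΨ _ _ (Finset.Subset.refl _)).1 ⟨c, h.1⟩ ⟨c', h.2⟩).trans ?_
      exact mul_le_of_le_one_right hc₁.le (exp_le_one_iff.2 (neg_nonpos.2 (by positivity)))
    · rw [abs_zero]; exact hc₁.le
  have hbdM : ∀ c c', |M c c'| ≤ c₁ := fun c c' => le_of_tendsto' (hM' c c').abs fun R => hbdR R c c'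
  -- Tannery
  have hdom : Summable fun b'' : X d => C * exp (-(δ * ∑ i, (((b i - b'' i).natAbs : ℕ) : ℝ))) * c₁ :=
    ((summable_exp_l1 hδ b).mul_left C).mul_right c₁
  have hlim : Tendsto (fun R : ℕ => ∑' b'' : X d, ((((n : ℝ) + 1) ^ d)⁻¹ * ∑ q ∈ B n b, Ψ b'' q) * MR R b'' b') atTop
      (𝓝 (∑' b'' : X d, ((((n : ℝ) + 1) ^ d)⁻¹ * ∑ q ∈ B n b, Ψ b'' q) * M b'' b')) := by
    refine tendsto_tsum_of_dominated_convergence hdom (fun b'' => (hM' b'' b').const_mul _) (Eventually.of_forall fun R b'' => ?_)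
    rw [Real.norm_eq_abs, abs_mul]
    exact mul_le_mul (hT b'') (hbdR R b'' b') (abs_nonneg _) ((abs_nonneg _).trans (hT b''))
  -- on the cubes containing `b, b′` the series IS the finite identity `T_S (T_S)⁻¹ = 1`
  set R₀ : ℕ := ∑ j, (b j).natAbs + ∑ j, (b' j).natAbs with hR₀
  have hconst : ∀ R : ℕ, R₀ ≤ R →
      ∑' b'' : X d, ((((n : ℝ) + 1) ^ d)⁻¹ * ∑ q ∈ B n b, Ψ b'' q) * MR R b'' b' = if b = b' then 1 else 0 := by
    intro R hR
    have hb : b ∈ (Fintype.piFinset fun _ : Fin d => Finset.Icc (-(R : ℤ)) R) := mem_cube_of_l1_le R b (by omega)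
    have hb' : b' ∈ (Fintype.piFinset fun _ : Fin d => Finset.Icc (-(R : ℤ)) R) := mem_cube_of_l1_le R b' (by omega)
    rw [tsum_eq_sum (s := Fintype.piFinset fun _ : Fin d => Finset.Icc (-(R : ℤ)) R)
      (fun b'' hb'' => by rw [hMR, dif_neg (fun h => hb'' h.1), mul_zero])]
    rw [← Finset.sum_coe_sort]
    have hid := (zd_coarse_section_identities hd a ha hlam hLam n V hV hV' Ψ BΨ hΨB hΨ _ ⟨b, hb⟩ ⟨b', hb'⟩).1
    simp only [Subtype.mk.injEq] at hid
    rw [← hid]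
    refine Finset.sum_congr rfl fun x _ => ?_
    rw [hMR, dif_pos ⟨x.2, hb'⟩]
  have hlim' : Tendsto (fun R : ℕ => ∑' b'' : X d, ((((n : ℝ) + 1) ^ d)⁻¹ * ∑ q ∈ B n b, Ψ b'' q) * MR R b'' b') atTop
      (𝓝 (if b = b' then 1 else 0)) :=
    tendsto_const_nhds.congr' (Filter.eventually_atTop.2 ⟨R₀, fun R hR => (hconst R hR).symm⟩)
  refine ⟨Summable.of_norm_bounded hdom fun b'' => ?_, tendsto_nhds_unique hlim hlim'⟩
  rw [Real.norm_eq_abs, abs_mul]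
  exact mul_le_mul (hT b'') (hbdM b'' b') (abs_nonneg _) ((abs_nonneg _).trans (hT b''))

include hd ha hlam hLam hV hV' hΨB hΨ hM in
/-- **`M·T_∞ = 1`**: `Σ′_{b″}M(b,b″)T_∞(b″,b′) = δ_{bb′}` — §3 `zd_coarse_mul_inverse` at `(b′, b)` read through the symmetry of `M` (§2) and of
`T_∞` ((194) `zd_coarse_symmetric'`). [folklore] -/
theorem zd_coarse_inverse_mul (b b' : X d) :
    Summable (fun b'' : X d => M b b'' * ((((n : ℝ) + 1) ^ d)⁻¹ * ∑ q ∈ B n b'', Ψ b' q)) ∧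
    ∑' b'' : X d, M b b'' * ((((n : ℝ) + 1) ^ d)⁻¹ * ∑ q ∈ B n b'', Ψ b' q) = if b = b' then 1 else 0 := by
  have h := zd_coarse_mul_inverse hd a ha hlam hLam n V hV hV' Ψ BΨ hΨB hΨ M hM b' b
  have heq : (fun b'' : X d => M b b'' * ((((n : ℝ) + 1) ^ d)⁻¹ * ∑ q ∈ B n b'', Ψ b' q))
      = fun b'' : X d => ((((n : ℝ) + 1) ^ d)⁻¹ * ∑ q ∈ B n b', Ψ b'' q) * M b'' b := by
    funext b''
    rw [zd_coarse_inverse_symmetric hd a ha hlam hLam n V hV hV' Ψ BΨ hΨB hΨ M hM b b'',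
      zd_coarse_symmetric' hd a ha hlam hLam n V hV hV' Ψ BΨ hΨB hΨ b'' b', mul_comm]
  rw [heq]
  refine ⟨h.1, h.2.trans ?_⟩
  by_cases hbb : b = b'
  · rw [if_pos hbb, if_pos hbb.symm]
  · rw [if_neg hbb, if_neg (Ne.symm hbb)]

/-! ## §4. Uniqueness: a bounded one-sided inverse kernel of `T_∞` is `M` -/

include hd ha hlam hLam hV hV' hΨB hΨ hM in
/-- **UNIQUENESS OF THE BOUNDED LEFT INVERSE**: if `|N(b,b′)| ≤ K` and `Σ′_{b‴}N(b,b‴)T_∞(b‴,b″) = δ_{bb″}` for all `b, b″`, then `N = M` —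
`N = N(T_∞M) = (NT_∞)M = M`, the exchange of the two series justified by the absolute convergence of
`Σ_{b″,b‴}|N(b,b‴)||T_∞(b‴,b″)||M(b″,b′)| ≤ K·C·K_δ·c₁·K_{δ₁}` ((186) entries in `b‴`, §3's decay of `M` in `b″`). [folklore] -/
theorem zd_coarse_left_inverse_unique (N : X d → X d → ℝ) (K : ℝ) (hNK : ∀ b b', |N b b'| ≤ K)
    (hN : ∀ b b'' : X d, ∑' b''' : X d, N b b''' * ((((n : ℝ) + 1) ^ d)⁻¹ * ∑ q ∈ B n b''', Ψ b'' q) = if b = b'' then 1 else 0)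
    (b b' : X d) : N b b' = M b b' := by
  classical
  obtain ⟨C, δ, hC, hδ, H186⟩ := zd_coarse_entry_decay (d := d) hd a ha hlam hLam
  obtain ⟨c₁, δ₁, hc₁, hδ₁, hMdec⟩ := zd_coarse_inverse_decay hd a ha hlam hLam n V hV hV' Ψ BΨ hΨB hΨ M hM
  have hK : 0 ≤ K := (abs_nonneg _).trans (hNK b b)
  obtain ⟨Tf, hTf⟩ : ∃ Tf : X d → X d → ℝ, ∀ c c', Tf c c' = (((n : ℝ) + 1) ^ d)⁻¹ * ∑ q ∈ B n c, Ψ c' q := ⟨_, fun _ _ => rfl⟩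
  have hT : ∀ c c' : X d, |Tf c c'| ≤ C * exp (-(δ * ∑ i, (((c i - c' i).natAbs : ℕ) : ℝ))) := fun c c' => by
    rw [hTf]; exact H186 n V hV hV' Ψ BΨ hΨB hΨ c c'
  simp only [← hTf] at hN
  have hTM := fun c => (zd_coarse_mul_inverse hd a ha hlam hLam n V hV hV' Ψ BΨ hΨB hΨ M hM c b')
  simp only [← hTf] at hTM
  -- the double family `f b″ b‴ = N(b,b‴)T(b‴,b″)M(b″,b′)` is absolutely summable on `ℤ^d × ℤ^d`
  set f : X d → X d → ℝ := fun b'' b''' => N b b''' * Tf b''' b'' * M b'' b' with hf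
  set g : X d × X d → ℝ := fun p => K * (C * exp (-(δ * ∑ i, (((p.1 i - p.2 i).natAbs : ℕ) : ℝ))))
    * (c₁ * exp (-(δ₁ * ∑ i, (((p.1 i - b' i).natAbs : ℕ) : ℝ)))) with hg
  have hg0 : 0 ≤ g := fun p => by simp only [hg]; positivity
  have hgsum : Summable g := by
    refine (summable_prod_of_nonneg hg0).2 ⟨fun b'' => ?_, ?_⟩
    · simp only [hg]
      exact (((summable_exp_l1 hδ b'').mul_left C).mul_left K).mul_right _
    · simp only [hg]
      have hrow : ∀ b'' : X d, ∑' b''' : X d, K * (C * exp (-(δ * ∑ i, (((b'' i - b''' i).natAbs : ℕ) : ℝ))))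
          * (c₁ * exp (-(δ₁ * ∑ i, (((b'' i - b' i).natAbs : ℕ) : ℝ))))
          = K * C * (c₁ * exp (-(δ₁ * ∑ i, (((b'' i - b' i).natAbs : ℕ) : ℝ))))
            * ∑' b''' : X d, exp (-(δ * ∑ i, (((b'' i - b''' i).natAbs : ℕ) : ℝ))) := by
        intro b''
        rw [← tsum_mul_left]
        exact tsum_congr fun b''' => by ring
      simp only [hrow]
      have hs' : Summable fun b'' : X d => exp (-(δ₁ * ∑ i, (((b'' i - b' i).natAbs : ℕ) : ℝ))) :=
        (summable_exp_l1 hδ₁ b').congr fun b'' => by rw [natAbs_sub_comm_sum b' b'']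
      refine Summable.of_nonneg_of_le (fun b'' => by positivity) (fun b'' => ?_)
        (((hs'.mul_left c₁).mul_left (K * C)).mul_right ((2 * (1 - exp (-δ))⁻¹) ^ d))
      have h1 := tsum_exp_l1_le hδ b''
      have h2 : 0 ≤ K * C * (c₁ * exp (-(δ₁ * ∑ i, (((b'' i - b' i).natAbs : ℕ) : ℝ)))) := by positivity
      exact mul_le_mul_of_nonneg_left h1 h2
  have hfsum : Summable (Function.uncurry f) := by
    refine Summable.of_norm_bounded hgsum fun p => ?_
    simp only [Function.uncurry, hf, hg, Real.norm_eq_abs, abs_mul]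
    have e1 := hNK b p.2
    have e2 := hT p.2 p.1
    have e3 := hMdec p.1 b'
    rw [natAbs_sub_comm_sum p.2 p.1] at e2
    exact mul_le_mul (mul_le_mul e1 e2 (abs_nonneg _) hK) e3 (abs_nonneg _) (by positivity)
  -- `N = N(TM) = (NT)M = M`
  calc N b b' = ∑' b''' : X d, N b b''' * (if b''' = b' then 1 else 0) := by
        rw [tsum_eq_single b' (fun b''' hb''' => by rw [if_neg hb''', mul_zero]), if_pos rfl, mul_one]
    _ = ∑' b''' : X d, N b b''' * ∑' b'' : X d, Tf b''' b'' * M b'' b' := tsum_congr fun b''' => by rw [(hTM b''').2]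
    _ = ∑' b''' : X d, ∑' b'' : X d, f b'' b''' := tsum_congr fun b''' => by
        rw [← tsum_mul_left]; exact tsum_congr fun b'' => by simp only [hf]; ring
    _ = ∑' b'' : X d, ∑' b''' : X d, f b'' b''' := hfsum.tsum_comm
    _ = ∑' b'' : X d, (∑' b''' : X d, N b b''' * Tf b''' b'') * M b'' b' := tsum_congr fun b'' => by
        rw [← tsum_mul_right]
    _ = ∑' b'' : X d, (if b = b'' then 1 else 0) * M b'' b' := tsum_congr fun b'' => by rw [hN b b'']
    _ = M b b' := by
        rw [tsum_eq_single b (fun b'' hb'' => by rw [if_neg (Ne.symm hb''), zero_mul]), if_pos rfl, one_mul]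

include hd ha hlam hLam hV hV' hΨB hΨ hM in
/-- **UNIQUENESS OF THE BOUNDED RIGHT INVERSE**: if `|N| ≤ K` and `Σ′_{b″}T_∞(b,b″)N(b″,b′) = δ_{bb′}`, then `N = M` — the transpose of `N` is
a bounded left inverse (symmetry of `T_∞`), hence `M`, and `M` is symmetric. [folklore] -/
theorem zd_coarse_right_inverse_unique (N : X d → X d → ℝ) (K : ℝ) (hNK : ∀ b b', |N b b'| ≤ K)
    (hN : ∀ b b' : X d, ∑' b'' : X d, ((((n : ℝ) + 1) ^ d)⁻¹ * ∑ q ∈ B n b, Ψ b'' q) * N b'' b' = if b = b' then 1 else 0)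
    (b b' : X d) : N b b' = M b b' := by
  have h := zd_coarse_left_inverse_unique hd a ha hlam hLam n V hV hV' Ψ BΨ hΨB hΨ M hM (fun c c' => N c' c) K
    (fun c c' => hNK c' c) (fun c c'' => ?_) b' b
  · rw [h]; exact zd_coarse_inverse_symmetric hd a ha hlam hLam n V hV hV' Ψ BΨ hΨB hΨ M hM b' b
  · have h1 := hN c'' c
    have heq : (fun b''' : X d => N b''' c * ((((n : ℝ) + 1) ^ d)⁻¹ * ∑ q ∈ B n b''', Ψ c'' q))
        = fun b''' : X d => ((((n : ℝ) + 1) ^ d)⁻¹ * ∑ q ∈ B n c'', Ψ b''' q) * N b''' c := by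
      funext b'''
      rw [zd_coarse_symmetric' hd a ha hlam hLam n V hV hV' Ψ BΨ hΨB hΨ b''' c'', mul_comm]
    rw [heq, h1]
    by_cases hcc : c = c''
    · rw [if_pos hcc, if_pos hcc.symm]
    · rw [if_neg hcc, if_neg (Ne.symm hcc)]

end Road

/-! ## §5. Toy -/

/-- Toy (`d = 3`): a function on `ℤ³ × ℤ³` vanishing off the diagonal sums to its diagonal value. -/
example (N : X 3 → ℝ) (b' : X 3) : ∑' b''' : X 3, N b''' * (if b''' = b' then (1 : ℝ) else 0) = N b' := by
  rw [tsum_eq_single b' (fun b''' hb''' => by rw [if_neg hb''', mul_zero]), if_pos rfl, mul_one]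

end Summit.QuantumFields.BalabanUV.T4Continuum.NE7b.SupZdCoarseInverseIdentities
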